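import Summits.Ventures.FusionMHD.Bench.SolovevPCFIterMercierEdgeSubst
import HarnessLib

/-!
# F1 / MERCIER at the ITER-like PCF edge — KERNEL BRIDGE 2/4: the `t`-integrals `∫w`, `∫∂w/∂r`, `∫(u√u)⁻¹`,
# `∫lcQKernelDr` of the GGJ input bridge equal rational multiples of the certified `K₁, K₂, K₄ = edgeI, K₃`
(venture LADDER-GRIDFUSION, rung F1.MERCIER-profile; cell `gridfusion`, seat `gridfusion-sos-6` (g3), 2026-08-27; see
`…MercierEdgeSubst` for the purpose of the series.)

With `c = 2257675225/6032287802`, `u, w, G` = `lcU, lcAvgWeight, lcGradSq` of `Ψ = psiLC κ₀ g R_a q₀(g) (ε/R_a)` on the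
edge loop (`g > 0`): continuity of the integrands (so the two substitution lemmas apply), then
`T1: ∫₀^{2π} w = (κ₀/c)K₁`, `T2: ∫₀^{2π} ∂w/∂r = −(κ₀R_a/c)K₂`, `T3: ∫₀^π (u√u)⁻¹ = K₄`, `T4: ∫₀^π lcQKernelDr = −3R_a K₃`
— each by the substitution, the §2 dictionary at `θ(w)` / `π − θ(w)`, and the closed forms `toFun_K…e` of the Data files
(pointwise `ring`/`field_simp` on `[0,1]`, then `integral_congr`).
HONEST FRAMING (LADDER-GRIDFUSION three columns, never merged): CERTIFIED = kernel identities/inequalities about the MODEL's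
edge surface (ideal MHD, axisymmetric, Solov'ev profiles `μ₀p′ = −1`, `FF′ = 0`, analytic fixed-boundary PCF equilibrium
[cite: PatakiCerfonFreidberg2013, §6.1], free constant `F = RB_φ` a parameter); VALIDATED cross-checks live in
`pub/gridfusion/cert/F/mercier-dm-validated.md`; Mercier/GGJ is a NECESSARY (local interchange) criterion; nothing here says
any plasma or device is stable. No `native_decide`; no `decide` in this file (the enclosures are the imported Data files').
-/

noncomputable section

open Real MeasureTheory Set intervalIntegral
open Literature.Analysis.ValidatedNumerics Literature.Analysis.ValidatedNumerics.PolyMP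
open Literature.Analysis.ValidatedNumerics.ExpPoly (Poly)
open Literature.MathematicalPhysics.MHD Literature.MathematicalPhysics.MHD.Solovev
open Summit.Ventures.FusionMHD.Models.SolovevPCF

namespace Summit.Ventures.FusionMHD.Bench.SolovevPCFIter.MercierEdge

/-! ## §3 The nine atomic `t`-integrals of the GGJ input bridge as the certified `w`-integrals

Abbreviations in the docstrings: `κ₀, R_a, q₀(g), a = ε/R_a` the Lee–Cerfon parameters of the ITER-like instance
(`IterLike.psi_eq_psiLC`), `c = 2257675225/6032287802 = 1/2 + 4d₃`, `u, w, G` = `lcU, lcAvgWeight, lcGradSq` on the edge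
loop, `K₁…K₈, KX, KY` the certified reals of `…MercierEdgeData1/2`, `…Averages` (`K₄ = edgeI`). -/

section atomic

variable {g : ℝ} (hg : 0 < g)
include hg

/-- Positivity package on the edge loop (`u, G > 0`). [folklore] -/
theorem lcGradSq_edge_pos (t : ℝ) :
    0 < lcGradSq IterLike.kappa0 g IterLike.Ra (IterLike.q0 g) (IterLike.ε / IterLike.Ra) t :=
  lcGradSq_pos IterLike.Ra_pos IterLike.kappa0_pos hg (IterLike.q0_pos hg) IterLike.edge_minorRadius.1
    IterLike.edge_minorRadius.2 t

omit hg in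
/-- Continuity of `u`. [folklore] -/
theorem continuous_lcU_edge : Continuous (lcU IterLike.Ra (IterLike.ε / IterLike.Ra)) := by
  unfold lcU; fun_prop

omit hg in
/-- Non-vanishing denominators on the edge loop (for `fun_prop`). [folklore] -/
theorem edge_denoms_ne (t : ℝ) :
    lcU IterLike.Ra (IterLike.ε / IterLike.Ra) t ≠ 0
    ∧ lcU IterLike.Ra (IterLike.ε / IterLike.Ra) t * Real.sqrt (lcU IterLike.Ra (IterLike.ε / IterLike.Ra) t) ≠ 0
    ∧ lcU IterLike.Ra (IterLike.ε / IterLike.Ra) t ^ 2 * Real.sqrt (lcU IterLike.Ra (IterLike.ε / IterLike.Ra) t) ≠ 0 := by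
  have hu := lcU_edge_pos t
  have hs := Real.sqrt_pos.2 hu
  exact ⟨hu.ne', by positivity, by positivity⟩

/-- Continuity of `w`. [folklore] -/
theorem continuous_w_edge :
    Continuous (lcAvgWeight IterLike.kappa0 g IterLike.Ra (IterLike.q0 g) (IterLike.ε / IterLike.Ra)) :=
  continuous_lcAvgWeight IterLike.Ra_pos IterLike.kappa0_pos hg (IterLike.q0_pos hg)
    IterLike.edge_minorRadius.1.le IterLike.edge_minorRadius.2

omit hg in
/-- Continuity of `G = |∇Ψ|²` along the loop. [folklore] -/
theorem continuous_lcGradSq_edge :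
    Continuous (lcGradSq IterLike.kappa0 g IterLike.Ra (IterLike.q0 g) (IterLike.ε / IterLike.Ra)) := by
  have hu : ∀ t, lcU IterLike.Ra (IterLike.ε / IterLike.Ra) t ≠ 0 := fun t => (lcU_edge_pos t).ne'
  have cu := continuous_lcU_edge
  have e : lcGradSq IterLike.kappa0 g IterLike.Ra (IterLike.q0 g) (IterLike.ε / IterLike.Ra)
      = fun t => (2 * (IterLike.kappa0 * g / (2 * IterLike.Ra ^ 3 * IterLike.q0 g)) * (IterLike.ε / IterLike.Ra)
          * IterLike.Ra) ^ 2 * (lcU IterLike.Ra (IterLike.ε / IterLike.Ra) t * Real.sin t ^ 2 / IterLike.kappa0 ^ 2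
          + (lcU IterLike.Ra (IterLike.ε / IterLike.Ra) t * Real.cos t
              + IterLike.ε / IterLike.Ra * IterLike.Ra * Real.sin t ^ 2) ^ 2
              / lcU IterLike.Ra (IterLike.ε / IterLike.Ra) t) := by
    funext t; rfl
  rw [e]
  exact continuous_const.mul (((cu.mul (Real.continuous_sin.pow 2)).div_const _).add
    ((((cu.mul Real.continuous_cos).add (continuous_const.mul (Real.continuous_sin.pow 2))).pow 2).div cu hu))

/-- `T1`: `∫₀^{2π} w dt = (κ₀/c)·K₁`. [folklore] -/
theorem integral_w_edge :
    ∫ t in (0 : ℝ)..(2 * π), lcAvgWeight IterLike.kappa0 g IterLike.Ra (IterLike.q0 g) (IterLike.ε / IterLike.Ra) t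
      = IterLike.kappa0 / (2257675225 / 6032287802 : ℝ) * K1 := by
  have hg' := hg.ne'
  rw [integral_zero_two_pi_eq_theta _ (continuous_w_edge hg)
    (fun t => by rw [lcAvgWeight_edge hg', lcAvgWeight_edge hg', lcU_two_pi_sub])]
  have key : ∀ w ∈ uIcc (0:ℝ) 1,
      (lcAvgWeight IterLike.kappa0 g IterLike.Ra (IterLike.q0 g) (IterLike.ε / IterLike.Ra) (theta w)
        + lcAvgWeight IterLike.kappa0 g IterLike.Ra (IterLike.q0 g) (IterLike.ε / IterLike.Ra) (π - theta w))
        * (2 / Real.sqrt (2 - w ^ 2))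
      = IterLike.kappa0 / (2 * (2257675225 / 6032287802 : ℝ)) * (K1e.toFun w * Poly.eval [2] w) := by
    intro w hw
    rw [uIcc01] at hw
    rw [lcAvgWeight_edge hg', lcAvgWeight_edge hg', lcU_theta hw, lcU_pi_sub_theta hw, toFun_K1e,
      eval_const_two, div_eq_mul_inv 2]
    ring
  rw [integral_congr key, intervalIntegral.integral_const_mul]
  unfold K1
  ring

/-- `T2`: `∫₀^{2π} ∂w/∂r dt = −(κ₀R_a/c)·K₂`. [folklore] -/
theorem integral_wDr_edge :
    ∫ t in (0 : ℝ)..(2 * π), lcAvgWeightDr IterLike.kappa0 g IterLike.Ra (IterLike.q0 g) (IterLike.ε / IterLike.Ra) t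
      = -(IterLike.kappa0 * IterLike.Ra / (2257675225 / 6032287802 : ℝ)) * K2 := by
  have hg' := hg.ne'
  have hc : Continuous
      (lcAvgWeightDr IterLike.kappa0 g IterLike.Ra (IterLike.q0 g) (IterLike.ε / IterLike.Ra)) := by
    have e : lcAvgWeightDr IterLike.kappa0 g IterLike.Ra (IterLike.q0 g) (IterLike.ε / IterLike.Ra)
        = fun t => -(IterLike.kappa0 * IterLike.Ra / (2 * (2257675225 / 6032287802 : ℝ)))
          * (Real.cos t * (lcU IterLike.Ra (IterLike.ε / IterLike.Ra) t
              * Real.sqrt (lcU IterLike.Ra (IterLike.ε / IterLike.Ra) t))⁻¹) := by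
      funext t; exact lcAvgWeightDr_edge hg' t
    rw [e]
    have hden : ∀ t, lcU IterLike.Ra (IterLike.ε / IterLike.Ra) t
        * Real.sqrt (lcU IterLike.Ra (IterLike.ε / IterLike.Ra) t) ≠ 0 := fun t => (edge_denoms_ne t).2.1
    have cu : Continuous (lcU IterLike.Ra (IterLike.ε / IterLike.Ra)) := continuous_lcU_edge
    exact continuous_const.mul (Real.continuous_cos.mul ((cu.mul cu.sqrt).fun_inv₀ hden))
  rw [integral_zero_two_pi_eq_theta _ hc
    (fun t => by rw [lcAvgWeightDr_edge hg', lcAvgWeightDr_edge hg', lcU_two_pi_sub, Real.cos_two_pi_sub])]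
  have key : ∀ w ∈ uIcc (0:ℝ) 1,
      (lcAvgWeightDr IterLike.kappa0 g IterLike.Ra (IterLike.q0 g) (IterLike.ε / IterLike.Ra) (theta w)
        + lcAvgWeightDr IterLike.kappa0 g IterLike.Ra (IterLike.q0 g) (IterLike.ε / IterLike.Ra) (π - theta w))
        * (2 / Real.sqrt (2 - w ^ 2))
      = -(IterLike.kappa0 * IterLike.Ra / (2 * (2257675225 / 6032287802 : ℝ)))
          * (K2e.toFun w * Poly.eval [2] w) := by
    intro w hw
    rw [uIcc01] at hw
    rw [lcAvgWeightDr_edge hg', lcAvgWeightDr_edge hg', lcU_theta hw, lcU_pi_sub_theta hw, Real.cos_pi_sub,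
      cos_theta hw, toFun_K2e, eval_const_two, div_eq_mul_inv 2]
    unfold splus sminus
    ring
  rw [integral_congr key, intervalIntegral.integral_const_mul]
  unfold K2
  ring

omit hg in
/-- `T3`: `∫₀^π (u√u)⁻¹ dt = K₄ = edgeI`. [folklore] -/
theorem integral_qKernel_edge :
    ∫ t in (0 : ℝ)..π, (lcU IterLike.Ra (IterLike.ε / IterLike.Ra) t
        * Real.sqrt (lcU IterLike.Ra (IterLike.ε / IterLike.Ra) t))⁻¹ = K4 := by
  have cu : Continuous (lcU IterLike.Ra (IterLike.ε / IterLike.Ra)) := continuous_lcU_edge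
  have hden : ∀ t, lcU IterLike.Ra (IterLike.ε / IterLike.Ra) t
      * Real.sqrt (lcU IterLike.Ra (IterLike.ε / IterLike.Ra) t) ≠ 0 := fun t => (edge_denoms_ne t).2.1
  have hc : Continuous fun t => (lcU IterLike.Ra (IterLike.ε / IterLike.Ra) t
      * Real.sqrt (lcU IterLike.Ra (IterLike.ε / IterLike.Ra) t))⁻¹ := (cu.mul cu.sqrt).fun_inv₀ hden
  rw [integral_zero_pi_eq_theta _ hc]
  have key : ∀ w ∈ uIcc (0:ℝ) 1,
      ((lcU IterLike.Ra (IterLike.ε / IterLike.Ra) (theta w)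
          * Real.sqrt (lcU IterLike.Ra (IterLike.ε / IterLike.Ra) (theta w)))⁻¹
        + (lcU IterLike.Ra (IterLike.ε / IterLike.Ra) (π - theta w)
          * Real.sqrt (lcU IterLike.Ra (IterLike.ε / IterLike.Ra) (π - theta w)))⁻¹)
        * (2 / Real.sqrt (2 - w ^ 2))
      = edgeIntegrand.toFun w * Poly.eval [2] w := by
    intro w hw
    rw [uIcc01] at hw
    rw [lcU_theta hw, lcU_pi_sub_theta hw, toFun_edgeIntegrand, eval_const_two, div_eq_mul_inv 2, mul_inv, mul_inv]
    ring
  rw [integral_congr key]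
  rfl

omit hg in
/-- `T4`: `∫₀^π lcQKernelDr dt = −3R_a·K₃`. [folklore] -/
theorem integral_qKernelDr_edge :
    ∫ t in (0 : ℝ)..π, lcQKernelDr IterLike.Ra (IterLike.ε / IterLike.Ra) t = -(3 * IterLike.Ra) * K3 := by
  have cu : Continuous (lcU IterLike.Ra (IterLike.ε / IterLike.Ra)) := continuous_lcU_edge
  have hc : Continuous (lcQKernelDr IterLike.Ra (IterLike.ε / IterLike.Ra)) := by
    have e : lcQKernelDr IterLike.Ra (IterLike.ε / IterLike.Ra) = fun t => -(3 * (IterLike.Ra * Real.cos t))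
        / (lcU IterLike.Ra (IterLike.ε / IterLike.Ra) t ^ 2 * Real.sqrt (lcU IterLike.Ra (IterLike.ε / IterLike.Ra) t)) := by
      funext t; rfl
    rw [e]
    have hden : ∀ t, lcU IterLike.Ra (IterLike.ε / IterLike.Ra) t ^ 2
        * Real.sqrt (lcU IterLike.Ra (IterLike.ε / IterLike.Ra) t) ≠ 0 := fun t => (edge_denoms_ne t).2.2
    fun_prop (disch := assumption)
  rw [integral_zero_pi_eq_theta _ hc]
  have key : ∀ w ∈ uIcc (0:ℝ) 1,
      (lcQKernelDr IterLike.Ra (IterLike.ε / IterLike.Ra) (theta w)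
        + lcQKernelDr IterLike.Ra (IterLike.ε / IterLike.Ra) (π - theta w)) * (2 / Real.sqrt (2 - w ^ 2))
      = -(3 * IterLike.Ra) * (K3e.toFun w * Poly.eval [2] w) := by
    intro w hw
    rw [uIcc01] at hw
    unfold lcQKernelDr
    rw [lcU_theta hw, lcU_pi_sub_theta hw, Real.cos_pi_sub, cos_theta hw, toFun_K3e, eval_const_two,
      div_eq_mul_inv 2]
    have h1 : Uplus w ≠ 0 := (Uplus_pos hw).ne'
    have h2 : Uminus w ≠ 0 := (Uminus_pos w).ne'
    have h3 : Real.sqrt (Uplus w) ≠ 0 := (Real.sqrt_pos.2 (Uplus_pos hw)).ne'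
    have h4 : Real.sqrt (Uminus w) ≠ 0 := (Real.sqrt_pos.2 (Uminus_pos w)).ne'
    have h5 : Real.sqrt (2 - w ^ 2) ≠ 0 := (sqrt_two_sub_pos hw).ne'
    unfold splus sminus
    field_simp
    ring
  rw [integral_congr key, intervalIntegral.integral_const_mul]
  unfold K3
  ring

end atomic

end Summit.Ventures.FusionMHD.Bench.SolovevPCFIter.MercierEdge

end
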